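import Summits.CriticalPhenomena.PercolationContinuityZ3.Theorems.Transplant.SkelFrm1Closure
import Summits.CriticalPhenomena.PercolationContinuityZ3.Theorems.Transplant.SkelPhiStepIFrQFrom
import Summits.CriticalPhenomena.PercolationContinuityZ3.Theorems.Transplant.PlanarSkeletonFrmFrom1
import HarnessLib

/-!
# U-WAVE PORT (RULING D-U, lead g21 2026-08-26; WAVE-U-MANIFEST v3.1 row idx 4 «SkelFrm1Closure» ↦ «SkelFrmFrom1Closure», flag NON-VERBATIM (r4)) —
# THE CLOSURE BASE OF THE UNIVERSAL ONE-TYPE NODE U: `PlanarSkeletonFrmFrom.samePDropOfSkeletonFrmFrom₁_of_stepI_frQ` (+ the two normal-form twins it needs,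
# `samePDropOfSkeletonFrmFrom₁_iff_minimal'` and `samePDropOfSkeletonFrmFrom₁_of_subexponential_case'`)

ORIGINAL TITLE: N2 (the frames-only node `SamePDropOfSkeletonFrm₁`, OPEN), WAVE 0 (c2) file 1: THE CLOSURE BASE OF RECORD — the quadrant index set of the ORIENTED
Step-I‴ family, Step I‴ over it, the θ-LEVEL drop engine (scheme-agnostic), and `PlanarSkeletonFrm.samePDropOfSkeletonFrm₁_of_stepI_frQ` (p3-g15).

builds on p205010 (kernel theorem, internal audit signed; external expert review pending) — nothing in this file uses p205010; the node U `SamePDropOfSkeletonFrmFrom₁`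
(PlanarSkeletonFrmFromDefs :154) stays OPEN: this is a CONDITIONAL assembly, its hypothesis `h` is the obligation the ported columns discharge in W2; NOTHING is claimed
about U / U_s / the end state.  Lane `prim-bschramm`, seat `prim-bschramm-p3` gen 26 (design owner); helper file (`--supports stmt-CriticalPhenomena-4575 --as helper`).
WHAT IS NOT RE-DECLARED (treatment (m1)): §1–§2 of the original (`Skelφ.StepI.sgQ/indexNQ/…/exists_stepI_frQ_indexP/unpackNQ`, `Skelφ.exists_drop_of_inputs_theta'`) are
φ-level and imported from «SkelFrm1Closure».  WHAT CHANGES (the three (κ)-reads of the closed node's used term, P3-NILPOTENT §19.2/§19.8, and nothing else):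
(i) `Φ.cyl_connected` ((κ′), `∀ ℓ ≥ Φ.ℓ₀`) feeds `Skelφ.StepI.exists_stepI_frQ_indexP_from` («SkelPhiStepIFrQFrom» p435426) instead of `exists_stepI_frQ_indexP`;
(ii) `Φ.graph_connected`, `Φ.isQuasiTransitive_frmFrom`, `Φ.criticalProb_lt_one`, `Φ.numInfiniteClusters_le_one` come from «PlanarSkeletonFrmFrom1» (W0.1(a) p439512);
(iii) the carrier token and the node name (`SamePDropOfSkeletonFrm₁ ↦ SamePDropOfSkeletonFrmFrom₁`, whose body additionally carries `G.Connected` in the same position —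
token-for-token the body of PlanarSkeletonFrm1 :193 with the carrier swapped).  Proof texts otherwise those of SkelFrm1Closure :196–:236 and PlanarSkeletonFrm1 :234–:262.
[cite: KozmaNitzan2024, §1 p. 2 (approach 1); §4 Theorem 6 (pp. 25–31), p. 17 (Step I)] [cite: MartineauTassion2017, §3.2 Lemma 3.5, §3.3 Lemma 3.7] [cite: LyonsPeres2016, Thm. 7.6]
[cite: Hutchcroft2016, Thm. 1] [cite: BenjaminiSchramm1996, Conj. 4] [cite: GrimmettPercolation1999, §7.3 p. 162]
-/

noncomputable section

open MeasureTheory ProbabilityTheory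
open scoped ENNReal Classical

namespace Summit.CriticalPhenomena.PercolationContinuityZ3.Theorems.Transplant

open Literature.Probability.Percolation Literature.Probability.LatticeModels SimpleGraph KNLevels
open Literature.Barriers.CriticalPhenomena (IsQuasiTransitive IsGraphAmenable HasExponentialGrowth hasExponentialGrowth_of_not_isGraphAmenable
  Hutchcroft2016_noPercolationAtCriticality_holds BurtonKeane1989_atMostOneInfiniteCluster_holds countable_of_connected_of_locallyFinite)

/-! ## §1 Normal forms of the universal node U (twins of PlanarSkeletonFrm1 :234–:262 over `PlanarSkeletonFrmFrom`) -/

/-- **The universal one-type node in minimal form**: ↔ `θ_t(p_c) = 0` for every locally finite `G` with a one-type `PlanarSkeletonFrmFrom` and Φ2 at `p_c` — connectedness,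
countability, quasi-transitivity, uniqueness and `p_c < 1` are supplied by the skeleton (growth split: Hutchcroft / Burton–Keane; connectedness from (ι) + (κ′), W0.1).
[cite: BenjaminiSchramm1996, Conj. 4] [cite: Hutchcroft2016, Thm. 1] [cite: LyonsPeres2016, Thm. 7.6] -/
theorem samePDropOfSkeletonFrmFrom₁_iff_minimal' : SamePDropOfSkeletonFrmFrom₁ ↔
    ∀ {V : Type} (G : SimpleGraph V) [G.LocallyFinite] (Φ : PlanarSkeletonFrmFrom G), ∀ t ∈ Φ.types, Φ.types = {t} →
      Φ.CylSubcritical (criticalProbIOf G t) → theta G t (criticalProbIOf G t) = 0 := by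
  rw [samePDropOfSkeletonFrmFrom₁_iff_critical]
  constructor
  · intro hK V G _ Φ t ht h1 hC
    have hc : G.Connected := Φ.graph_connected t
    haveI : Countable V := countable_of_connected_of_locallyFinite G hc t
    have hq : IsQuasiTransitive G := Φ.isQuasiTransitive_frmFrom
    by_cases hg : HasExponentialGrowth G
    · exact Hutchcroft2016_noPercolationAtCriticality_holds G hc hq hg t
    · have ha : IsGraphAmenable G := by_contra fun hna => hg (hasExponentialGrowth_of_not_isGraphAmenable G hq hna)
      exact hK G Φ hc t ht h1 (Φ.criticalProb_lt_one t) (BurtonKeane1989_atMostOneInfiniteCluster_holds G hc hq ha _) hC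
  · intro h V _ _ G _ Φ _ t ht h1 _ _ hC
    exact h G Φ t ht h1 hC

/-- **ENTRY POINT OF A U CLOSURE**: to prove the universal one-type node it suffices to treat graphs NOT of exponential growth, one-type skeletons, under Φ2 at `p_c`.
[cite: Hutchcroft2016, Thm. 1] [cite: BenjaminiSchramm1996, Conj. 4] -/
theorem samePDropOfSkeletonFrmFrom₁_of_subexponential_case'
    (h : ∀ {V : Type} (G : SimpleGraph V) [G.LocallyFinite] (Φ : PlanarSkeletonFrmFrom G), ¬ HasExponentialGrowth G →
      ∀ t ∈ Φ.types, Φ.types = {t} → Φ.CylSubcritical (criticalProbIOf G t) → theta G t (criticalProbIOf G t) = 0) :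
    SamePDropOfSkeletonFrmFrom₁ := by
  refine samePDropOfSkeletonFrmFrom₁_iff_minimal'.2 fun G _ Φ t ht h1 hC => ?_
  by_cases hg : HasExponentialGrowth G
  · exact Hutchcroft2016_noPercolationAtCriticality_holds G (Φ.graph_connected t) Φ.isQuasiTransitive_frmFrom hg t
  · exact h G Φ hg t ht h1 hC

/-! ## §2 The closure base of the universal one-type node -/

namespace PlanarSkeletonFrmFrom

variable {V : Type} {G : SimpleGraph V} [G.LocallyFinite]

/-- **THE CLOSURE BASE OF THE UNIVERSAL ONE-TYPE NODE U (single type, cylinders connected from `ℓ₀` on).**  Suppose that for every locally finite `G` NOT of exponential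
growth with a one-type `PlanarSkeletonFrmFrom Φ` (`Φ.types = {t}`), every `0 < p < 1` with a.s. uniqueness, Φ2 (`hC`) and `θ_t(p) > 0`, the instance names
`0 < δI < 1` and `m₀`; receives the Step-I‴ output — records `D`, `DT`, preferred quadrants `qd`, `qdT`, orientation `ori` — with its facts (`m₀ ≤ k`, `1 ≤ k ≤ M₀`,
`R = ψ`, `Λ = fatSeq`, the shared fields of `DT`, and at every admissible `(M, n)` the geometric clause + shear bound of the chosen orientation); returns admissible
finite lists `Sz`, `SMn`; and at every `q ∈ [p/2, p]` where the ORIENTED Step-I‴ family over `indexNQ {t} Sz SMn (sgQ qd qdT ori)` holds with accuracy `δI` and Φ2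
holds, proves `θ_t(q) > 0`.  Then `SamePDropOfSkeletonFrmFrom₁`.  (Step I‴ under (κ′): `Skelφ.StepI.exists_stepI_frQ_indexP_from`; a closure wanting every consumed width
`≥ Φ.ℓ₀` names `m₀ ≥ Φ.ℓ₀`.) [cite: KozmaNitzan2024, §1 p. 2 (approach 1); §4 Theorem 6 (pp. 25–31), p. 17] [cite: MartineauTassion2017, §3.3 Lemma 3.7] -/
theorem samePDropOfSkeletonFrmFrom₁_of_stepI_frQ
    (h : ∀ {V : Type} [DecidableEq V] [Countable V] (G : SimpleGraph V) [G.LocallyFinite] (Φ : PlanarSkeletonFrmFrom G),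
      ¬ HasExponentialGrowth G → ∀ t ∈ Φ.types, Φ.types = {t} → ∀ p : unitInterval, 0 < (p : ℝ) → (p : ℝ) < 1 →
        (∀ᵐ ω ∂bondPercolation G p, numInfiniteClusters ω ≤ 1) → ∀ hC : Φ.CylSubcritical p, 0 < theta G t p →
          ∃ (δI : ℝ) (m₀ : ℕ), 0 < δI ∧ δI < 1 ∧
            ∀ (D DT : Skelφ.StepI.DataN V) (qd qdT : V → ℕ → ℕ → ℤˣ × ℤˣ) (ori : V → ℕ → ℕ → Bool),
              m₀ ≤ D.k → 1 ≤ D.k → D.k ≤ D.M₀ → D.R = Skelφ.fatRadius Φ.frame hC → D.Λ = Skelφ.fatSeq Φ.frame hC →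
              DT.Λ = D.Λ → DT.k = D.k → DT.R = D.R → DT.M₀ = D.M₀ → DT.n₁ = D.n₁ →
              (∀ M, D.M₀ ≤ M → ∀ n, D.n₁ M ≤ n →
                (ori t M n = true → D.EqGeom G Φ.φ t M n ∧ (D.hgt t M n).natAbs ≤ 10 * n) ∧
                (ori t M n = false → DT.EqGeom G (Skelφ.trφ Φ.φ) t M n ∧ (DT.hgt t M n).natAbs ≤ 10 * n)) →
              ∃ (Sz : Finset ℕ) (SMn : Finset (ℕ × ℕ)), (∀ M ∈ Sz, D.M₀ ≤ M) ∧ (∀ q ∈ SMn, D.M₀ ≤ q.1 ∧ D.n₁ q.1 ≤ q.2) ∧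
                ∀ q : unitInterval, (p : ℝ) / 2 ≤ q → (q : ℝ) ≤ p →
                  (∀ i ∈ Skelφ.StepI.indexNQ {t} Sz SMn (Skelφ.StepI.sgQ qd qdT ori),
                    1 - δI < (bondPercolation G q).real (Skelφ.StepI.eventO G Φ.φ D DT ori i)) →
                  Φ.CylSubcritical q → 0 < theta G t q) :
    SamePDropOfSkeletonFrmFrom₁ := by
  refine samePDropOfSkeletonFrmFrom₁_of_subexponential_case' fun {V} G _ Φ hg t ht h1 hC => ?_
  haveI : Countable V := countable_of_connected_of_locallyFinite G (Φ.graph_connected t) t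
  refine theta_criticalProbIOf_eq_zero_of_drop_at G t fun hθ => ?_
  have hp0 : 0 < ((criticalProbIOf G t : unitInterval) : ℝ) := PlanarSkeletonSign.pos_of_theta_pos hθ
  have hp1 : ((criticalProbIOf G t : unitInterval) : ℝ) < 1 := Φ.criticalProb_lt_one t
  have hU := Φ.numInfiniteClusters_le_one hg ht (criticalProbIOf G t)
  obtain ⟨δI, m₀, hδI, hδI1, hB⟩ := h G Φ hg t ht h1 _ hp0 hp1 hU hC hθ
  have hC' : Skelφ.CylSubcritical G Φ.φ Φ.types (criticalProbIOf G t) := hC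
  -- Step I‴ under (κ′) for the (single) type at `p_c`
  obtain ⟨D, DT, qd, qdT, ori, hk₀, hk₁, hkM, hR, hΛ, e1, e2, e3, e4, e5, hgeom, hfam⟩ :=
    Skelφ.StepI.exists_stepI_frQ_indexP_from (types := Φ.types) (Φ.graph_connected t).preconnected Φ.lip Φ.step Φ.frame
      Φ.cyl_connected hC' hp0 hp1 hU hθ hδI hδI1 m₀
  obtain ⟨Sz, SMn, hSz, hSMn, hq⟩ := hB D DT qd qdT ori hk₀ hk₁ hkM hR hΛ e1 e2 e3 e4 e5 (fun M hM n hn => hgeom t ht M hM n hn)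
  -- the structure-free pointwise drop with (A) := the oriented Step-I‴ family over the quadrant index set
  have hfam' := hfam Sz SMn hSz hSMn
  rw [h1] at hfam'
  exact Skelφ.exists_drop_of_inputs_theta' (φ := Φ.φ) (types := Φ.types) t hp0 hC'
    (Skelφ.StepI.indexNQ {t} Sz SMn (Skelφ.StepI.sgQ qd qdT ori)) (Skelφ.StepI.eventO G Φ.φ D DT ori) (Skelφ.StepI.edgesO G Φ.φ D DT ori)
    (fun _ => 1 - δI) (fun i _ => Skelφ.StepI.determinedBy_eventO G Φ.φ D DT ori i) hfam'
    fun q hq1 hq2 hcq hCq => hq q hq1 hq2 hcq hCq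

end PlanarSkeletonFrmFrom

end Summit.CriticalPhenomena.PercolationContinuityZ3.Theorems.Transplant

end
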